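import Literature.NumberTheory.Automorphic.UnitaryThreeDoubleCosetsHKDefs      -- ★ B-p17 DEFS: `flickerKH ∕ flickerHK ∕ flickerPH` + `mem_*_iff`
import Literature.NumberTheory.Automorphic.UnitaryThreeKHFactorization        -- ★ (F3c-β) B-p04: `block_relations_of_coe_eq`
import HarnessLib

/-!
# The tower `P_H ⊇ N₀(t) ⊇ P_H ∩ H^K_m` for Flicker's Prop. 8 (ii): the «scalar modulo `t`» subgroups `N(t)` and `N₀(t) = P_H ∩ N(t)` — DEFINITIONS,
# and `N₀(t)` in the coordinates `(u, x, w)` of `P_H`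
(Flicker, *Elementary proof of the fundamental lemma for a unitary group* (1998), Prop. 8 pp. 84–85)

Topic `NumberTheory/Automorphic`; namespace `Literature.NumberTheory.Automorphic.UnitaryGroup`.  DEFINITIONS `scalarCongr`, `flickerPH0` (+ `mem_iff`s and one coordinate
theorem); no instance, no notation, no named fact, no `sorry`.  Cell `pub/hodgecm-mathlib`, F0∕P3a road «N7-ns COUNT FROM FLICKER» (MAP v3, architect A-p06 (g26)),
brick **(F3c-β-ii) PROP. 8 (ii)** `[P_H : P_H ∩ H^K_m] = (q² − 1) q^{4m−2}` (B-p04 (g33); assigned by the LAYER C pen A-p03 (g24) 04:45:33Z with the TOWER plan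
`P_H ⊇ N₀ ⊇ S`, this file = its definitional base), over ★ B-p17 (g24)'s DEFS `UnitaryThreeDoubleCosetsHKDefs` (`flickerKH ∕ flickerHK ∕ flickerPH`).  HC_CM is proved
only modulo the printed citations until rung 0 closes; structure theory for ONE clause of #103-ns, pays nothing by itself.

FRAME (= ★ (F1)): `K` valued in `ℤᵐ⁰`, `U = unitaryGroupOfForm σ J` (`J = Φ₃` where needed), `K₀ = unitaryInt σ J`, `P_H = flickerPH σ J c` whose elements are
`!![u, 0, u x; 0, w, 0; 0, 0, (σu)⁻¹]` with `|u| = 1`, `|x| ≤ 1`, `σx = −x`, `|w| = 1`, `σw·w = 1` (★ A-p03 `exists_coe_eq_borel_of_mem_flickerPH`).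

* `forall_v_mul_sub_le` — «congruent to its middle entry modulo `t`» is stable under products of integral `3 × 3` matrices
  (`(PQ)ᵢⱼ − P₁₁Q₁₁δᵢⱼ = Σₖ (Pᵢₖ − P₁₁δᵢₖ)Qₖⱼ + P₁₁(Qᵢⱼ − Q₁₁δᵢⱼ)`).
* **`scalarCongr σ J t : Subgroup ↥U`** = `N(t) := {g ∈ K₀ : |gᵢⱼ − g₁₁δᵢⱼ| ≤ |t| and the same for g⁻¹}` («`g ≡ g₁₁·1 (mod t)`», i.e. `E¹·Γ(t) ∩ K₀`), `mem_scalarCongr_iff`.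
* **`flickerPH0 σ J c t := flickerPH σ J c ⊓ scalarCongr σ J t`** = Flicker's `N₀(t)`, `mem_flickerPH0_iff`, `flickerPH0_le`.
* **`mem_flickerPH0_iff_of_coe_eq`** — IN COORDINATES: `p(u,x,w) ∈ N₀(t) ⟺ |u w⁻¹ − 1| ≤ |t| ∧ |x| ≤ |t|` («`u ≡ w`, `x ≡ 0 (mod t)`»).
SEQUEL (theorems only): (H1) `ρ p = ρ p′ ↔ p⁻¹p′ ∈ N₀(ϖ^m)` for `ρ p = (u w⁻¹ mod ϖ^m, x mod ϖ^m)`, (H3) image + `Nat.card = (q²−1)q^{2m−2}·q^m`, (H2) `[N₀(ϖ^m) : P_H ∩ H^K_m] = q^m`.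

## References
* [Flicker1998UnitaryFL] Y. Z. Flicker, *Elementary proof of the fundamental lemma for a unitary group*, Canad. J. Math. 50 (1998), Prop. 8 pp. 84–85.
-/

open scoped MatrixGroups WithZero
open Matrix

namespace Literature.NumberTheory.Automorphic

namespace UnitaryGroup

open Literature.NumberTheory.Automorphic.HermitianLattice (unitaryInt mem_unitaryInt_iff LocalConjDatum)

section Defs

variable {K : Type*} [Field K] [Valued K ℤᵐ⁰] (σ : K →+* K) (J : Matrix (Fin 3) (Fin 3) K)

/-- «Congruent to a scalar modulo `t`» is preserved by products of INTEGRAL `3 × 3` matrices: if `P ≡ P₁₁·1` and `Q ≡ Q₁₁·1 (mod t)` entrywise then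
`PQ ≡ (PQ)₁₁·1 (mod t)`. [cite: Flicker1998UnitaryFL, Prop. 8 p. 84] -/
theorem forall_v_mul_sub_le {P Q : Matrix (Fin 3) (Fin 3) K} {t : K} (hP : ∀ i j, Valued.v (P i j) ≤ 1) (hQ : ∀ i j, Valued.v (Q i j) ≤ 1)
    (hPc : ∀ i j, Valued.v (P i j - P 1 1 * (1 : Matrix (Fin 3) (Fin 3) K) i j) ≤ Valued.v t)
    (hQc : ∀ i j, Valued.v (Q i j - Q 1 1 * (1 : Matrix (Fin 3) (Fin 3) K) i j) ≤ Valued.v t) :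
    ∀ i j, Valued.v ((P * Q) i j - (P * Q) 1 1 * (1 : Matrix (Fin 3) (Fin 3) K) i j) ≤ Valued.v t := by
  -- `(PQ)ᵢⱼ − P₁₁Q₁₁ δᵢⱼ = Σₖ (Pᵢₖ − P₁₁δᵢₖ) Qₖⱼ + P₁₁ (Qᵢⱼ − Q₁₁ δᵢⱼ)`
  have key : ∀ i j, Valued.v ((P * Q) i j - P 1 1 * Q 1 1 * (1 : Matrix (Fin 3) (Fin 3) K) i j) ≤ Valued.v t := by
    intro i j
    have e : (P * Q) i j - P 1 1 * Q 1 1 * (1 : Matrix (Fin 3) (Fin 3) K) i j =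
        ∑ k, (P i k - P 1 1 * (1 : Matrix (Fin 3) (Fin 3) K) i k) * Q k j + P 1 1 * (Q i j - Q 1 1 * (1 : Matrix (Fin 3) (Fin 3) K) i j) := by
      simp only [Matrix.mul_apply, Fin.sum_univ_three, Matrix.one_apply]
      fin_cases i <;> fin_cases j <;> simp <;> ring
    rw [e]
    refine Valuation.map_add_le _ (Valuation.map_sum_le _ fun k _ => ?_) ?_
    · rw [map_mul]; exact (mul_le_mul' (hPc i k) (hQ k j)).trans (by rw [mul_one])
    · rw [map_mul]; exact (mul_le_mul' (hP 1 1) (hQc i j)).trans (by rw [one_mul])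
  intro i j
  have h11 := key 1 1
  rw [Matrix.one_apply_eq, mul_one] at h11
  have e : (P * Q) i j - (P * Q) 1 1 * (1 : Matrix (Fin 3) (Fin 3) K) i j =
      ((P * Q) i j - P 1 1 * Q 1 1 * (1 : Matrix (Fin 3) (Fin 3) K) i j) - ((P * Q) 1 1 - P 1 1 * Q 1 1) * (1 : Matrix (Fin 3) (Fin 3) K) i j := by ring
  rw [e]
  refine Valuation.map_sub_le _ (key i j) ?_
  rw [map_mul]
  refine (mul_le_mul' h11 (?_ : Valued.v ((1 : Matrix (Fin 3) (Fin 3) K) i j) ≤ 1)).trans (by rw [mul_one])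
  rw [Matrix.one_apply]; split_ifs <;> simp

/-- **`N(t)`: the integral elements of `U` congruent to their own middle entry modulo `t`** (together with their inverses): `g ∈ K₀`,
`|gᵢⱼ − g₁₁ δᵢⱼ| ≤ |t|` and the same for `g⁻¹` — the subgroup `E¹ · Γ(t)` «scalar modulo `t`» cut down to `K₀`. [cite: Flicker1998UnitaryFL, Prop. 8 p. 84] -/
def scalarCongr (t : K) : Subgroup ↥(unitaryGroupOfForm σ J) where
  carrier := {g | g ∈ unitaryInt σ J ∧
    (∀ i j, Valued.v (((g : GL (Fin 3) K) : Matrix (Fin 3) (Fin 3) K) i j -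
      ((g : GL (Fin 3) K) : Matrix (Fin 3) (Fin 3) K) 1 1 * (1 : Matrix (Fin 3) (Fin 3) K) i j) ≤ Valued.v t) ∧
    ∀ i j, Valued.v ((((g : GL (Fin 3) K)⁻¹ : GL (Fin 3) K) : Matrix (Fin 3) (Fin 3) K) i j -
      (((g : GL (Fin 3) K)⁻¹ : GL (Fin 3) K) : Matrix (Fin 3) (Fin 3) K) 1 1 * (1 : Matrix (Fin 3) (Fin 3) K) i j) ≤ Valued.v t}
  mul_mem' := by
    rintro g h ⟨hgK, hg, hg'⟩ ⟨hhK, hh, hh'⟩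
    refine ⟨(unitaryInt σ J).mul_mem hgK hhK, ?_, ?_⟩
    · rw [Subgroup.coe_mul, Units.val_mul]
      exact forall_v_mul_sub_le (mem_unitaryInt_iff.1 hgK).1 (mem_unitaryInt_iff.1 hhK).1 hg hh
    · rw [Subgroup.coe_mul, _root_.mul_inv_rev, Units.val_mul]
      exact forall_v_mul_sub_le (mem_unitaryInt_iff.1 hhK).2 (mem_unitaryInt_iff.1 hgK).2 hh' hg'
  one_mem' := by
    refine ⟨(unitaryInt σ J).one_mem, fun i j => ?_, fun i j => ?_⟩ <;>
      simp [Matrix.one_apply_eq]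
  inv_mem' := by
    rintro g ⟨hgK, hg, hg'⟩
    refine ⟨(unitaryInt σ J).inv_mem hgK, ?_, ?_⟩
    · rw [Subgroup.coe_inv]; exact hg'
    · rw [Subgroup.coe_inv, inv_inv]; exact hg

variable {σ J} in
/-- Membership in `N(t)`, by definition. [cite: Flicker1998UnitaryFL, Prop. 8 p. 84] -/
theorem mem_scalarCongr_iff {t : K} {g : ↥(unitaryGroupOfForm σ J)} :
    g ∈ scalarCongr σ J t ↔ g ∈ unitaryInt σ J ∧
      (∀ i j, Valued.v (((g : GL (Fin 3) K) : Matrix (Fin 3) (Fin 3) K) i j -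
        ((g : GL (Fin 3) K) : Matrix (Fin 3) (Fin 3) K) 1 1 * (1 : Matrix (Fin 3) (Fin 3) K) i j) ≤ Valued.v t) ∧
      ∀ i j, Valued.v ((((g : GL (Fin 3) K)⁻¹ : GL (Fin 3) K) : Matrix (Fin 3) (Fin 3) K) i j -
        (((g : GL (Fin 3) K)⁻¹ : GL (Fin 3) K) : Matrix (Fin 3) (Fin 3) K) 1 1 * (1 : Matrix (Fin 3) (Fin 3) K) i j) ≤ Valued.v t := Iff.rfl

/-- **`N₀(t) := P_H ∩ N(t)`** — Flicker's intermediate subgroup of the tower `P_H ⊇ N₀(ϖ^m) ⊇ P_H ∩ H^K_m` («`u ≡ w (mod ϖ^m)`, `x ≡ 0 (mod ϖ^m)`»).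
[cite: Flicker1998UnitaryFL, Prop. 8 pp. 84–85] -/
def flickerPH0 (c : ↥(unitaryGroupOfForm σ J)) (t : K) : Subgroup ↥(unitaryGroupOfForm σ J) :=
  flickerPH σ J c ⊓ scalarCongr σ J t

variable {σ J} in
/-- Membership in `N₀(t)`, by definition. [cite: Flicker1998UnitaryFL, Prop. 8 pp. 84–85] -/
theorem mem_flickerPH0_iff {c : ↥(unitaryGroupOfForm σ J)} {t : K} {g : ↥(unitaryGroupOfForm σ J)} :
    g ∈ flickerPH0 σ J c t ↔ g ∈ flickerPH σ J c ∧ g ∈ scalarCongr σ J t := Iff.rfl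

variable {σ J} in
/-- `N₀(t) ≤ P_H`. [cite: Flicker1998UnitaryFL, Prop. 8 pp. 84–85] -/
theorem flickerPH0_le (c : ↥(unitaryGroupOfForm σ J)) (t : K) : flickerPH0 σ J c t ≤ flickerPH σ J c := inf_le_left

end Defs

section Coordinates

variable {K : Type*} [Field K] [Valued K ℤᵐ⁰] {ϖ : K} (σ : K →+* K) {J : Matrix (Fin 3) (Fin 3) K} (hJ : J = (StdForm.antidiagonal 3).over K)

/-- `rev` on `Fin 3`. [folklore] -/ private theorem rev0 : Fin.rev (0 : Fin 3) = 2 := rfl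
/-- `rev` on `Fin 3`. [folklore] -/ private theorem rev1 : Fin.rev (1 : Fin 3) = 1 := rfl
/-- `rev` on `Fin 3`. [folklore] -/ private theorem rev2 : Fin.rev (2 : Fin 3) = 0 := rfl

include hJ in
/-- **`N₀(t)` IN COORDINATES**: for `p = !![u, 0, u x; 0, w, 0; 0, 0, (σu)⁻¹] ∈ P_H` (`|u| = |w| = 1`, `σw·w = 1`, ★ `exists_coe_eq_borel_of_mem_flickerPH`) and any `t`,
`p ∈ N₀(t) ⟺ |u w⁻¹ − 1| ≤ |t| ∧ |x| ≤ |t|` («`u ≡ w`, `x ≡ 0 (mod t)`»). [cite: Flicker1998UnitaryFL, Prop. 8 pp. 84–85] -/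
theorem mem_flickerPH0_iff_of_coe_eq (hσv : ∀ a, Valued.v (σ a) = Valued.v a) (hσσ : ∀ a, σ (σ a) = a) {c p : ↥(unitaryGroupOfForm σ J)}
    (hp : p ∈ flickerPH σ J c) {u x w : K} (hcoe : ((p : GL (Fin 3) K) : Matrix (Fin 3) (Fin 3) K) = !![u, 0, u * x; 0, w, 0; 0, 0, (σ u)⁻¹])
    (hu : Valued.v u = 1) (hw : Valued.v w = 1) (hσw : σ w * w = 1) (t : K) :
    p ∈ flickerPH0 σ J c t ↔ Valued.v (u * w⁻¹ - 1) ≤ Valued.v t ∧ Valued.v x ≤ Valued.v t := by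
  have hu0 : u ≠ 0 := fun h => by rw [h, map_zero] at hu; exact zero_ne_one hu
  have hw0 : w ≠ 0 := fun h => by rw [h, map_zero] at hw; exact zero_ne_one hw
  have hσu0 : σ u ≠ 0 := fun h => hu0 (by rw [← hσσ u, h, map_zero])
  have vσu : Valued.v (σ u) = 1 := by rw [hσv, hu]
  have hwinv : w⁻¹ = σ w := by rw [inv_eq_of_mul_eq_one_left hσw]
  have hK : p ∈ unitaryInt σ J := (mem_flickerKH_iff.1 (mem_flickerPH_iff'.1 hp).1).2
  -- entries of `p⁻¹`
  have hinv : ∀ i j, ((((p : GL (Fin 3) K)⁻¹ : GL (Fin 3) K) : Matrix (Fin 3) (Fin 3) K) i j) =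
      σ (((p : GL (Fin 3) K) : Matrix (Fin 3) (Fin 3) K) (Fin.rev j) (Fin.rev i)) := inv_apply_of_mem σ hJ p
  -- the key valuation identities
  have e1 : Valued.v (u - w) = Valued.v (u * w⁻¹ - 1) := by
    rw [show u - w = (u * w⁻¹ - 1) * w by field_simp, map_mul, hw, mul_one]
  have e2 : Valued.v ((σ u)⁻¹ - w) = Valued.v (u * w⁻¹ - 1) := by
    have : (σ u)⁻¹ - w = -((σ u)⁻¹ * w) * σ (u - w) := by
      rw [map_sub, ← hwinv]; field_simp; ring
    rw [this, map_mul, Valuation.map_neg, map_mul, map_inv₀, vσu, inv_one, one_mul, hw, one_mul, hσv, e1]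
  have e3 : Valued.v (u * x) = Valued.v x := by rw [map_mul, hu, one_mul]
  have e4 : Valued.v (u⁻¹ - w⁻¹) = Valued.v (u * w⁻¹ - 1) := by
    have : u⁻¹ - w⁻¹ = -(u⁻¹ * w⁻¹) * (u - w) := by field_simp; ring
    rw [this, map_mul, Valuation.map_neg, map_mul, map_inv₀, map_inv₀, hu, hw, inv_one, one_mul, one_mul, e1]
  have e5 : Valued.v (σ (u * x)) = Valued.v x := by rw [hσv, e3]
  have e6 : Valued.v (σ u - σ w) = Valued.v (u * w⁻¹ - 1) := by rw [← map_sub, hσv, e1]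
  rw [mem_flickerPH0_iff, mem_scalarCongr_iff]
  simp only [hp, hK, true_and]
  constructor
  · rintro ⟨h, -⟩
    have h00 := h 0 0
    have h02 := h 0 2
    rw [hcoe] at h00 h02
    simp at h00 h02
    rw [hu, one_mul] at h02
    exact ⟨by rwa [← e1], h02⟩
  · rintro ⟨huw, hx⟩
    refine ⟨fun i j => ?_, fun i j => ?_⟩
    · rw [hcoe]
      fin_cases i <;> fin_cases j <;> simp
      · rwa [e1]
      · rw [hu, one_mul]; exact hx
      · rwa [e2]
    · rw [hinv, hinv, hcoe]
      fin_cases i <;> fin_cases j <;> simp [rev1, rev2, map_zero, ← hwinv]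
      · rw [hσσ]; rwa [e4]
      · rw [vσu, one_mul, hσv]; exact hx
      · rw [hwinv, e6]; exact huw

end Coordinates

end UnitaryGroup

end Literature.NumberTheory.Automorphic
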